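import Mathlib

/-!
# Crux `RefutationDegree.BeyondHessianSos` (stmt-ValiantsHypothesis-5643), line `Sketch` —
# stub `stub_sliceDim` (dimension count of the border slice)

Pure linear algebra.  A flat `W` of `(p+3) × (p+3)` matrices (indexed by
`Fin (p+3) × Fin (p+3)`) is sliced by the coordinate subspace
`S' = {v | v (0, j.succ) = 0 ∧ v (i.succ, 0) = 0}` ("off-corner border zero"), which is the
kernel of the border map into `(Fin (p+2) → ℂ) × (Fin (p+2) → ℂ)` and hence has codimension
at most `2 (p+2)`.  If every `v ∈ W ∩ S'` has vanishing corner `v (0,0) = 0`, the restriction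
to the lower-right block is injective on `W ∩ S'`, so its image `L` has the same dimension as
`W ∩ S'`, and `finrank W ≤ finrank L + 2 (p+2)` by the dimension formula for `W ⊔ S'`, `W ⊓ S'`.
-/

set_option linter.dupNamespace false

noncomputable section

namespace Summit.ValiantsHypothesis.ValiantsHypothesis.Theorems.RefutationDegreeBeyondHessianSos

/-- **Stub `stub_sliceDim` (dimension count of the border slice).**
Let `W` be a subspace of `(p+3) × (p+3)` matrices such that every `v ∈ W` whose off-corner
border vanishes (`v (0, j.succ) = 0` and `v (i.succ, 0) = 0`) also has `v (0, 0) = 0`.  Then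
there is a subspace `L` of `(p+2) × (p+2)` matrices, every element of which is the lower-right
block of some border-vanishing `v ∈ W`, with `finrank W ≤ finrank L + 2 (p + 2)`.
(Take `L` to be the image of `W ⊓ S'` under the block-restriction map, `S'` the kernel of the
border map; the corner hypothesis makes the restriction injective on `W ⊓ S'`, and `S'` has
codimension at most `2 (p + 2)`.) -/
theorem stub_sliceDim (p : ℕ) (W : Submodule ℂ (Fin (p + 3) × Fin (p + 3) → ℂ))
    (hcorner : ∀ v ∈ W, (∀ j : Fin (p + 2), v (0, j.succ) = 0) →
      (∀ i : Fin (p + 2), v (i.succ, 0) = 0) → v (0, 0) = 0) :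
    ∃ L : Submodule ℂ (Fin (p + 2) × Fin (p + 2) → ℂ),
      (∀ B ∈ L, ∃ v ∈ W, (∀ j : Fin (p + 2), v (0, j.succ) = 0) ∧
        (∀ i : Fin (p + 2), v (i.succ, 0) = 0) ∧ ∀ i j : Fin (p + 2), v (i.succ, j.succ) = B (i, j)) ∧
      Module.finrank ℂ W ≤ Module.finrank ℂ L + 2 * (p + 2) := by
  -- the border map `v ↦ (top border, left border)` (corner excluded); its kernel is `S'`
  let f : (Fin (p + 3) × Fin (p + 3) → ℂ) →ₗ[ℂ] (Fin (p + 2) → ℂ) × (Fin (p + 2) → ℂ) :=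
    { toFun := fun v => (fun j => v (0, j.succ), fun i => v (i.succ, 0))
      map_add' := fun _ _ => rfl
      map_smul' := fun _ _ => rfl }
  -- the block-restriction map `v ↦ (lower-right (p+2) × (p+2) block of v)`
  let π : (Fin (p + 3) × Fin (p + 3) → ℂ) →ₗ[ℂ] (Fin (p + 2) × Fin (p + 2) → ℂ) :=
    { toFun := fun v ij => v (ij.1.succ, ij.2.succ)
      map_add' := fun _ _ => rfl
      map_smul' := fun _ _ => rfl }
  -- membership in the kernel of `f` is vanishing of the off-corner border
  have hker : ∀ v ∈ LinearMap.ker f,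
      (∀ j : Fin (p + 2), v (0, j.succ) = 0) ∧ ∀ i : Fin (p + 2), v (i.succ, 0) = 0 := by
    intro v hv
    have hv' : f v = 0 := LinearMap.mem_ker.mp hv
    exact ⟨fun j => by simpa [f] using congrArg (fun x => x.1 j) hv',
      fun i => by simpa [f] using congrArg (fun x => x.2 i) hv'⟩
  refine ⟨(W ⊓ LinearMap.ker f).map π, ?_, ?_⟩
  · -- every `B ∈ L` is the block of some border-vanishing `v ∈ W`
    intro B hB
    obtain ⟨v, hv, rfl⟩ := Submodule.mem_map.mp hB
    obtain ⟨hvW, hvS⟩ := Submodule.mem_inf.mp hv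
    exact ⟨v, hvW, (hker v hvS).1, (hker v hvS).2, fun i j => rfl⟩
  · -- dimension count
    -- (a) `π` is injective on `W ⊓ S'`: a kernel vector has zero block, zero border, zero corner
    have hinj : Function.Injective (π.comp (W ⊓ LinearMap.ker f).subtype) := by
      rw [← LinearMap.ker_eq_bot, Submodule.eq_bot_iff]
      rintro ⟨v, hv⟩ hv0
      obtain ⟨hvW, hvS⟩ := Submodule.mem_inf.mp hv
      obtain ⟨hb1, hb2⟩ := hker v hvS
      have hc : v (0, 0) = 0 := hcorner v hvW hb1 hb2
      have hblk : ∀ i j : Fin (p + 2), v (i.succ, j.succ) = 0 := fun i j => by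
        simpa [π] using congrFun (LinearMap.mem_ker.mp hv0) (i, j)
      refine Subtype.ext (funext fun ab => ?_)
      obtain ⟨a, b⟩ := ab
      rcases Fin.eq_zero_or_eq_succ a with rfl | ⟨i, rfl⟩ <;>
        rcases Fin.eq_zero_or_eq_succ b with rfl | ⟨j, rfl⟩
      · simpa using hc
      · simpa using hb1 j
      · simpa using hb2 i
      · simpa using hblk i j
    -- (b) hence `finrank L = finrank (W ⊓ S')`
    have hL : Module.finrank ℂ ↥((W ⊓ LinearMap.ker f).map π) =
        Module.finrank ℂ ↥(W ⊓ LinearMap.ker f) := by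
      rw [← LinearMap.finrank_range_of_inj hinj, LinearMap.range_comp, Submodule.range_subtype]
    -- (c) the dimension formula and rank–nullity for the border map
    have hsum := Submodule.finrank_sup_add_finrank_inf_eq W (LinearMap.ker f)
    have hle : Module.finrank ℂ ↥(W ⊔ LinearMap.ker f) ≤
        Module.finrank ℂ (Fin (p + 3) × Fin (p + 3) → ℂ) := Submodule.finrank_le _
    have hrn := LinearMap.finrank_range_add_finrank_ker f
    have hrange : Module.finrank ℂ ↥(LinearMap.range f) ≤ 2 * (p + 2) := by
      calc Module.finrank ℂ ↥(LinearMap.range f)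
          ≤ Module.finrank ℂ ((Fin (p + 2) → ℂ) × (Fin (p + 2) → ℂ)) := Submodule.finrank_le _
        _ = 2 * (p + 2) := by
          rw [Module.finrank_prod, Module.finrank_fintype_fun_eq_card, Fintype.card_fin]; ring
    rw [hL]
    omega

end Summit.ValiantsHypothesis.ValiantsHypothesis.Theorems.RefutationDegreeBeyondHessianSos

end
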